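import Mathlib
import HarnessLib
import Summits.NavierStokesRegularity.NavierStokesRegularity.Theorems.WakeRatchetMinimalViscousBlowupThresholdContinuity

/-!
# Threshold ray (crux `WakeRatchet.MinimalViscousBlowup`, ⟨stmt-NavierStokesRegularity-22743⟩) — the HEART α2 is only needed
# BELOW THE THRESHOLD BLOW-UP TIME: `α2♭ ⇒ S3b` (kernel), and `α2 ⇒ α2♭`

In the registered skeleton `threshold_ray_line_v310.lean` (ebed8644) the heart stub α2 `stub_ceilingCriticalWindow` asks, at a threshold
viscosity `ν`, for EVERY horizon `T₀ > 0`, a window `(ν, ν+δ)` and a ceiling `S₂` with `(1+ε₀)ⁿ‖X'_n(t)‖² ≤ S₂ν'²` for every global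
`ν'`-solution, every shell and every `t ∈ [0, T₀]` — including times AFTER the threshold blow-up time `T⋆` of the exact `ν`-trajectory.  The
composition, however, consumes α2 only through `thresholdEnvelope_of_split`, i.e. only at `T₀ = T⋆` and only at times `t < T⋆`.  This file
makes that precise:
* `thresholdEnvelope_of_ceilingBelowBlowup` — **α2♭ ⇒ S3b**: along a `ν`-trajectory `X` on `[0,T)` from the cascade datum ((4.5)-regular on every
  `[0,T']`), if there are ONE window `(ν, ν+δ)` and ONE ceiling `S₂` such that every global `ν'`-solution, `ν < ν' < ν+δ`, obeys
  `(1+ε₀)ⁿ‖X'_n(t)‖² ≤ S₂ν'²` for all `n` and all `t < T` (α2♭: the ceiling in the critical window BELOW `T` only), and global solutions exist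
  at every `ν' > ν`, then `X` carries the CRITICAL ENVELOPE `(1+ε₀)ⁿ‖X_n(t)‖² ≤ C` on `[0,T)` — the conclusion of S3b `thresholdEnvelope_of_split`
  (proof: the landed continuity at the threshold from above, `thresholdContinuity` p706544, at each `t < T` with tolerance `1`, at a viscosity
  inside the window; no compact-window stub α1 and no post-blow-up information is used).
* `ceilingBelow_of_ceilingAllHorizons` — α2's conclusion (all horizons) trivially gives α2♭ for every `T > 0`.
READING (census, with g1's `ceilingCriticalWindow_below_blowupTime` p816901: α2 holds for every horizon `T₀ < T⋆`): the line's analytic residual is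
EXACTLY the uniformity of `(δ, S₂)` as `T₀ ↑ T⋆` — «no runaway AT the threshold blow-up time» — and nothing about near-threshold solutions after
`T⋆`; the «no overshoot past `T⋆`» half of α2 as typed is NOT load-bearing for ⟨22743⟩.  (A land-only hand does not reshape the stub; this is
the kernel certificate a planner would cite to replace α2 by α2♭.)
MODEL lattice ODEs only (Tao 2016 §4, NS-scaled viscous lattice); nothing here is a statement about the Navier–Stokes equations; no registered
stub is closed by this file; no summit is proved by it.
-/

noncomputable section

set_option linter.dupNamespace false

open Set Filter Topology

namespace Summit.NavierStokesRegularity.NavierStokesRegularity.Theorems.MinimalViscousBlowup.ThresholdRay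

open Literature.Analysis.FluidPDE Literature.Analysis.FluidPDE.TaoCascade

/-- **α2♭ ⇒ S3b.**  Along a `ν`-viscous lattice trajectory `X` on `[0,T)` from the one-shell datum `X₀` ((4.5)-regular on every `[0,T']`,
`T' < T`), a SINGLE window `(ν, ν+δ)` with a SINGLE ceiling `S₂` for the shell Reynolds numbers of the global `ν'`-solutions at times `t < T`,
together with global solutions at every `ν' > ν`, forces the critical envelope `(1+ε₀)ⁿ‖X_n(t)‖² ≤ C` on `[0,T)`.  MODEL lattice only.
[cite: Tao2016AveragedNS, §4, the viscous equation before Thm. 4.2 and Lemma 4.1 (4.5), (4.7), (4.11)] -/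
theorem thresholdEnvelope_of_ceilingBelowBlowup {ε₀ R ν T : ℝ} (hε : 0 < ε₀) (hR : 1 ≤ R)
    {α : Fin 4 → Fin 4 → Fin 4 → ℤ × ℤ × ℤ → ℝ} {X₀ : Fin 4 → ℝ} (hα : InTableClass R α) (hν : 0 < ν)
    (habove : ∀ ν' : ℝ, ν < ν' → ∃ X : Fin 4 → ℤ → ℝ → ℝ, ViscousGlobal ε₀ ν' α X₀ X)
    {X : Fin 4 → ℤ → ℝ → ℝ} (hT : 0 < T)
    (hcd : ∀ i n, ContDiffOn ℝ 1 (X i n) (Set.Ico 0 T))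
    (hinit : ∀ i n, X i n 0 = if n = 0 then X₀ i else 0)
    (hlow : ∀ i n t, n < 0 → X i n t = 0)
    (hmot : ∀ i n t, 0 ≤ t → t < T → derivWithin (X i n) (Set.Ici 0) t =
      quadTerm ε₀ α X i n t - ν * (1 + ε₀) ^ ((2 : ℝ) * n) * X i n t)
    (hregT : ∀ T' : ℝ, 0 < T' → T' < T → ∃ M : ℝ, ∀ t : ℝ, 0 ≤ t → t ≤ T' →
      ∀ (i : Fin 4) (n : ℤ), (1 + (1 + ε₀) ^ ((10 : ℝ) * n)) * |X i n t| ≤ M)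
    (hceil : ∃ δ : ℝ, 0 < δ ∧ ∃ S₂ : ℝ, ∀ ν' : ℝ, ν < ν' → ν' < ν + δ →
      ∀ X' : Fin 4 → ℤ → ℝ → ℝ, ViscousGlobal ε₀ ν' α X₀ X' →
      ∀ (n : ℤ) (t : ℝ), 0 ≤ t → t < T → (1 + ε₀) ^ n * ‖shellVec X' n t‖ ^ 2 ≤ S₂ * ν' ^ 2) :
    ∃ C : ℝ, ∀ (n : ℤ) (t : ℝ), 0 ≤ t → t < T → (1 + ε₀) ^ n * ‖shellVec X n t‖ ^ 2 ≤ C := by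
  obtain ⟨δ, hδ, S₂, hS₂⟩ := hceil
  refine ⟨max S₂ 0 * (2 * ν) ^ 2 + 1, fun n t ht htT => ?_⟩
  -- continuity at time `t` with tolerance `1`
  obtain ⟨δ₁, hδ₁, hclose⟩ :=
    thresholdContinuity ε₀ hε R hR α X₀ hα ν hν T X hT hcd hinit hlow hmot hregT t ht htT 1 one_pos
  -- a viscosity strictly inside both windows and below `2ν`
  set ν' : ℝ := ν + min (min δ δ₁) ν / 2 with hν'
  have hmin : 0 < min (min δ δ₁) ν := lt_min (lt_min hδ hδ₁) hν
  have h1 : ν < ν' := by rw [hν']; linarith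
  have h2 : ν' < ν + δ := by
    rw [hν']; linarith [(min_le_left (min δ δ₁) ν).trans (min_le_left δ δ₁)]
  have h2' : ν' < ν + δ₁ := by
    rw [hν']; linarith [(min_le_left (min δ δ₁) ν).trans (min_le_right δ δ₁)]
  have h3 : ν' ≤ 2 * ν := by
    rw [hν']; linarith [min_le_right (min δ δ₁) ν]
  have h0' : 0 ≤ ν' := le_of_lt (hν.trans h1)
  obtain ⟨X', hX'⟩ := habove ν' h1
  have hc := hclose ν' h1 h2' X' hX' n
  have hceil' := hS₂ ν' h1 h2 X' hX' n t ht htT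
  have hsq : ν' ^ 2 ≤ (2 * ν) ^ 2 := pow_le_pow_left₀ h0' h3 2
  have hS : S₂ * ν' ^ 2 ≤ max S₂ 0 * (2 * ν) ^ 2 :=
    (mul_le_mul_of_nonneg_right (le_max_left S₂ 0) (sq_nonneg ν')).trans
      (mul_le_mul_of_nonneg_left hsq (le_max_right S₂ 0))
  linarith

/-- **α2 ⇒ α2♭** (trivial direction): the all-horizons ceiling of the registered stub α2 gives, for every `T > 0`, a single window and ceiling
for the times `t < T` (take the horizon `T₀ := T`).  Recorded so that the two directions sit side by side.  MODEL lattice only.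
[cite: Tao2016AveragedNS, §4, the viscous equation before Thm. 4.2] -/
theorem ceilingBelow_of_ceilingAllHorizons {ε₀ ν T : ℝ}
    {α : Fin 4 → Fin 4 → Fin 4 → ℤ × ℤ × ℤ → ℝ} {X₀ : Fin 4 → ℝ} (hT : 0 < T)
    (hα2 : ∀ T₀ : ℝ, 0 < T₀ → ∃ δ : ℝ, 0 < δ ∧ ∃ S₂ : ℝ, ∀ ν' : ℝ, ν < ν' → ν' < ν + δ →
      ∀ X' : Fin 4 → ℤ → ℝ → ℝ, ViscousGlobal ε₀ ν' α X₀ X' →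
      ∀ (n : ℤ) (t : ℝ), 0 ≤ t → t ≤ T₀ → (1 + ε₀) ^ n * ‖shellVec X' n t‖ ^ 2 ≤ S₂ * ν' ^ 2) :
    ∃ δ : ℝ, 0 < δ ∧ ∃ S₂ : ℝ, ∀ ν' : ℝ, ν < ν' → ν' < ν + δ →
      ∀ X' : Fin 4 → ℤ → ℝ → ℝ, ViscousGlobal ε₀ ν' α X₀ X' →
      ∀ (n : ℤ) (t : ℝ), 0 ≤ t → t < T → (1 + ε₀) ^ n * ‖shellVec X' n t‖ ^ 2 ≤ S₂ * ν' ^ 2 := by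
  obtain ⟨δ, hδ, S₂, hS₂⟩ := hα2 T hT
  exact ⟨δ, hδ, S₂, fun ν' h1 h2 X' hX' n t ht htT => hS₂ ν' h1 h2 X' hX' n t ht htT.le⟩

/-- **S3b from α2♭ in the composition's binders.**  The statement of the skeleton's `thresholdEnvelope_of_split` (S3b: no runaway at threshold)
with the heart α2 replaced by the hypothesis α2♭ attached to the trajectory: threshold data, a maximal `ν`-trajectory on `[0,T)`, and ONE
window/ceiling below `T` give the critical envelope.  (The unused threshold hypotheses are kept so that the binder list is the skeleton's.)
MODEL lattice only.  [cite: Tao2016AveragedNS, §4, the viscous equation before Thm. 4.2 and Lemma 4.1 (4.5), (4.7), (4.11)] -/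
theorem thresholdEnvelope_of_ceilingBelowBlowup' : ∀ ε₀ : ℝ, 0 < ε₀ → ∀ R : ℝ, 1 ≤ R →
    ∀ (α : Fin 4 → Fin 4 → Fin 4 → ℤ × ℤ × ℤ → ℝ) (X₀ : Fin 4 → ℝ),
    InTableClass R α →
    NoGlobalCascade ε₀ α X₀ →
    ∀ ν : ℝ, 0 < ν →
    (¬ ∃ X : Fin 4 → ℤ → ℝ → ℝ, ViscousGlobal ε₀ ν α X₀ X) →
    (∀ ν' : ℝ, ν < ν' → ∃ X : Fin 4 → ℤ → ℝ → ℝ, ViscousGlobal ε₀ ν' α X₀ X) →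
    ∀ (T : ℝ) (X : Fin 4 → ℤ → ℝ → ℝ), 0 < T →
    (∀ i n, ContDiffOn ℝ 1 (X i n) (Set.Ico 0 T)) →
    (∀ i n, X i n 0 = if n = 0 then X₀ i else 0) →
    (∀ i n t, n < 0 → X i n t = 0) →
    (∀ i n t, 0 ≤ t → t < T → derivWithin (X i n) (Set.Ici 0) t =
      quadTerm ε₀ α X i n t - ν * (1 + ε₀) ^ ((2 : ℝ) * n) * X i n t) →
    (∀ T' : ℝ, 0 < T' → T' < T → ∃ M : ℝ, ∀ t : ℝ, 0 ≤ t → t ≤ T' →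
      ∀ (i : Fin 4) (n : ℤ), (1 + (1 + ε₀) ^ ((10 : ℝ) * n)) * |X i n t| ≤ M) →
    (∀ M : ℝ, ∃ t : ℝ, 0 ≤ t ∧ t < T ∧
      ∃ (i : Fin 4) (n : ℤ), M < (1 + (1 + ε₀) ^ ((10 : ℝ) * n)) * |X i n t|) →
    (∃ δ : ℝ, 0 < δ ∧ ∃ S₂ : ℝ, ∀ ν' : ℝ, ν < ν' → ν' < ν + δ →
      ∀ X' : Fin 4 → ℤ → ℝ → ℝ, ViscousGlobal ε₀ ν' α X₀ X' →
      ∀ (n : ℤ) (t : ℝ), 0 ≤ t → t < T → (1 + ε₀) ^ n * ‖shellVec X' n t‖ ^ 2 ≤ S₂ * ν' ^ 2) →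
    ∃ C : ℝ, ∀ (n : ℤ) (t : ℝ), 0 ≤ t → t < T → (1 + ε₀) ^ n * ‖shellVec X n t‖ ^ 2 ≤ C := by
  intro ε₀ hε R hR α X₀ hα _hng ν hν _hnreg habove T X hT hcd hinit hlow hmot hregT _hblow hceil
  exact thresholdEnvelope_of_ceilingBelowBlowup hε hR hα hν habove hT hcd hinit hlow hmot hregT hceil

end Summit.NavierStokesRegularity.NavierStokesRegularity.Theorems.MinimalViscousBlowup.ThresholdRay

end
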